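import Summits.QuantumFields.BalabanUV.Beta.GAN24.VertexSlotZeroMode
import Summits.QuantumFields.BalabanUV.Beta.GAN24.ExchangeSlotResum
import Summits.QuantumFields.BalabanUV.Beta.GAN24.TwoFaceWordAdditive
import Summits.QuantumFields.BalabanUV.Beta.SpineRecursiveW
import Summits.QuantumFields.BalabanUV.Beta.SecondOrderTransport

/-!
# `BalabanUV.Beta.GAN24.ContactWordSlotZeroMode` — binder row G-an2-4 ∕ (CONV-C), row (C) at the levels `j ≥ 1`, CONTACT side; Part 28 of
# `GAN24/FourFaceGaugeSectors`: **THE SLOT ZERO MODE OF THE TWO CONTACT WORDS** — summing the second background slot `(κ′, u′)` of the face-weighted two-face words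
# `FF[A ∘ dM_{κ′u′}]` and `FF[dM_{κ′u′} ∘ B]` over the whole step lattice replaces the chain-rule derivative `dM G_j Lc S M κ′ u′` by `cH_j ×` the stencil family summed over
# the EXIT FACE of its own direction (Part 27's rule), read against the face weight of the leg it carries:
# `Σ_{u′} FF^{ρ₁ρ₂}_{ab}[A ∘ dM_{κ′u′}] = Σ_f Σ'_{(y,z)} ρ₁(y)·A y z a f·Σ'_w ρ₂(w)·cH_j·Σ'_t 𝟙[t_{κ′} % Lc = Lc−1]·S κ′ t z w f b`,
# `Σ_{u′} FF^{ρ₁ρ₂}_{ab}[dM_{κ′u′} ∘ B] = Σ_f Σ'_{(w,z)} ρ₂(w)·B z w f b·Σ'_y ρ₁(y)·cH_j·Σ'_t 𝟙[t_{κ′} % Lc = Lc−1]·S κ′ t y z a f`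
# — every `j`, in-block root, ANY local stencil family `S` and vertex family `M`, ANY localised `A` ∕ `B`, bounded leg weights; then the wall's instance
# (`S = SpureRecAt j`, `M = M1At j`, `A = dM_{κu} ∘ G_j`, `B = G_j ∘ dM_{κu}`): the two contact words `dM_{κu} G_j dM_{κ′u′}` and `dM_{κ′u′} G_j dM_{κu}` of Part 26's interior `Y_j`

NOT IN PRINT; OUR BOOKKEEPING (G-an2-4 crux team (2), leaf prover `b2b-balaban-gan24-formalise-leaf-02`, gen 67).  WHY.  Part 26 (`QuarticMemberZeroMode`) writes road-P2's
zero mode `zmode Lc (T2RecAt … (j+1)) κ κ′ (inl α)(inl β)` as `Σ_{r∈cell} Σ'_{u′} (cE₂·wV4 (j+1))·(−cH_j²)·FF[Y_j(κr; κ′u′)]` with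
`Y_j(b; b′) = dM_b G_j dM_{b′} + dM_{b′} G_j dM_b − WrecAt j b b′` on the exit faces; Part 27 (`VertexSlotZeroMode.hasSum_slot_dM`) is the rule for the slot total of ONE
chain-rule derivative, `Σ_{u′} dM G_j Lc S M κ′ u′ = cH_j·Σ'_{t exit_κ′} S κ′ t` (entrywise).  THIS FILE carries the rule through the two CONTACT words: the `Σ_{u′}` ↔ face-pair-sum
exchange is leaf-04's `ExchangeSlotResum.hasSum_slot_word ∕ _left` (the four-leg majorant of `ExchangeSlotFubini`), the (slot, leg) pair sum is `summable_pair_slot` + Fubini, and the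
left word is re-bracketed by an5's `TameKernelCalculus.comp_assoc_tame`.  What is left in each word is ONE localised factor (`dM_{κu} ∘ G_j` resp. `G_j ∘ dM_{κu}`) against the
face-weighted leg charge of the GLOBAL stencil `𝒮_{κ′} := Σ'_{t exit_κ′} S_j κ′ t` — the object the successor values by the stencil's gauge-leg letters one level down
(`SpureRecAt j = (cE·wE_j)•e3OfK G_{j−1}(SrecAt (j−1)) + (cVH·wVH_j)•vhSAt`).  The W-word `Σ_{u′} FF[WrecAt j (κu)(κ′u′)]` is Part 29.

WHAT (in-block root `ρ = toSite r`, `G_j = coDressKBmAt ρ Lc (KInvStep Lc j)`, `cH_j = (stepScale_j·Lc^{d+1})⁻¹`; [folklore] Fubini BY NAME; 0 `def`, 0 cited facts, 0 `def … : Prop`,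
0 sorry):
* §1 `exists_vertexFamily_dM` (the wall's `dM`-family through `G_j` is a vertex family for ANY `S`, `M`), **`tsum_pair_slot_dM`** ∕ **`tsum_pair_slot_dM_left`** (the (slot, leg)
  pair sums: `Σ'_{(u′,w)} ρ₂(w)·dM_{κ′u′} z w f b = Σ'_w ρ₂(w)·cH_j·Σ'_{t exit_κ′} S κ′ t z w f b`, and the left-leg twin).
* §2 **`hasSum_slot_word_dM_right`**, **`hasSum_slot_word_dM_left`** (the displayed identities, generic `A` ∕ `B` with an5's `Loc`).
* §3 the wall: `loc_dM_wall'`, `comp_assoc_contact_wall` (`(dM_{b′} ∘ G_j) ∘ dM_b = dM_{b′} ∘ (G_j ∘ dM_b)`), **`hasSum_slot_contactWord_right`**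
  (`Σ_{u′} FF[(dM_{κu} ∘ G_j) ∘ dM_{κ′u′}]`), **`hasSum_slot_contactWord_left`** (`Σ_{u′} FF[(dM_{κ′u′} ∘ G_j) ∘ dM_{κu}]`), **`hasSum_slot_contactWords`** (their sum, the
  contact part of `Σ_{u′} FF[Y_j(κu; κ′u′)]`).
HONEST FRAMING (cell contract, verbatim): «discharging `BetaPertH` makes Bałaban's UV stability UNCONDITIONAL — a real constructive-QFT result; it is NOT the continuum limit and
NOT the Clay problem.»  HONEST DEPENDENCY (verbatim): «continuum YM on T⁴ ⇐ BetaPertH ∧ nine spine estimates (0/9 proved); BetaPertH ⇐ (D1) ∧ (D4) ∧ CAP+tail; G-an2-4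
gates asym, D1 and NE2/3/4.»  Asserts NO value of any resolvent column beyond road-P2's two column charges (through Part 27); the global stencil's leg charges are NOT valued;
NOTHING of (C) at j ≥ 1 ∕ `hX` ∕ (C)sym ∕ (Q-L) ∕ (FL) ∕ «T2Shape» ∕ «T2Drift» ∕ (hW, hWall) discharged; NEVER «G-an2-4 closed» as (CONV-C); NOT D1, NOT `BetaPertH`, NOT continuum,
NOT Clay.  2026-08-23; no existing file touched.
-/

noncomputable section

open Finset
open scoped BigOperators
open Literature.MathematicalPhysics.QuantumFieldTheory
open Literature.MathematicalPhysics.QuantumFieldTheory.Balaban1983to89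
open Literature.MathematicalPhysics.QuantumFieldTheory.Balaban1983to89.Beta
open B12Sec2to5 (l1 l1_nonneg)
open ExpKernelCalculus (Site MKer BiLoc Decays VertexFamily comp)
open OneStepResolventKernel (Fib LocStencil)
open AffineAveraging (box toSite)
open OneStepKernelFamily (KInvStep)
open SecondOrderResponse (dM vertexFamily_dM)
open Summit.QuantumFields.BalabanUV.Beta.TameKernelCalculus
open Summit.QuantumFields.BalabanUV.Beta.AxialDressingRooted (coDressKBmAt decays_coDressKBmAt_KInvStep)
open Summit.QuantumFields.BalabanUV.Beta.BorderedHessian (stepScale)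
open Summit.QuantumFields.BalabanUV.Beta.SpineRooted (SpureRecAt M1At locStencil_SpureRecAt vertexFamily_M1At)
open Summit.QuantumFields.BalabanUV.Beta.GAN24.ExchangeSlotResum (hasSum_slot_word hasSum_slot_word_left summable_pair_slot)
open Summit.QuantumFields.BalabanUV.Beta.GAN24.TwoFaceWordAdditive (summable_twoFace_of_loc)
open Summit.QuantumFields.BalabanUV.Beta.GAN24.VertexSlotZeroMode (hasSum_slot_dM)

namespace Summit.QuantumFields.BalabanUV.Beta.GAN24.ContactWordSlotZeroMode

variable {d : ℕ} {Lc : ℕ} [NeZero Lc] {r : Fin (d + 1) → ℕ}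

/-! ## §1 The wall's `dM`-family is a vertex family; the (slot, leg) pair sums -/

section Generic

variable {S : Fin (d + 1) → Site (d + 1) → MKer (d + 1) (Fib d)} {Cs δs : ℝ}
  {M : Fin (d + 1) → Site (d + 1) → MKer (d + 1) (Fib d)} {CM δM : ℝ}

/-- [folklore] **THE CHAIN-RULE DERIVATIVES THROUGH `G_j` FORM A VERTEX FAMILY** for ANY local stencil family `S` and ANY vertex family `M` at positive rates (an2's
`vertexFamily_dM` over `decays_coDressKBmAt_KInvStep`, rates matched by lowering). -/
theorem exists_vertexFamily_dM (hr : r ∈ box (d + 1) Lc) (j : ℕ) (hS : LocStencil S Cs δs) (hδs : 0 < δs) (hM : VertexFamily M Lc CM δM) (hδM : 0 < δM) :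
    ∃ CQ δQ : ℝ, 0 < δQ ∧ VertexFamily (dM (coDressKBmAt (toSite r) Lc (KInvStep (d := d) Lc j)) Lc S M) Lc CQ δQ := by
  obtain ⟨δG, CG, hδG, hCG, hG⟩ := decays_coDressKBmAt_KInvStep (d := d) hr j
  have hm : 0 < min δG (min δs δM) := lt_min hδG (lt_min hδs hδM)
  have hS' : LocStencil S |Cs| (min δG (min δs δM)) := fun κ u => biLoc_of_le (hS κ u) ((min_le_right _ _).trans (min_le_left _ _))
  have hM' : VertexFamily M Lc |CM| (min δG (min δs δM)) := fun μ y => biLoc_of_le (hM μ y) ((min_le_right _ _).trans (min_le_right _ _))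
  exact ⟨_, _, half_pos hm, vertexFamily_dM hG hCG hS' hM' hm (min_le_left _ _)⟩

/-- [folklore] Every chain-rule derivative through `G_j` is localised (an5's `Loc`). -/
theorem loc_dM_wall' (hr : r ∈ box (d + 1) Lc) (j : ℕ) (hS : LocStencil S Cs δs) (hδs : 0 < δs) (hM : VertexFamily M Lc CM δM) (hδM : 0 < δM)
    (μ : Fin (d + 1)) (y : Site (d + 1)) : Loc (dM (coDressKBmAt (toSite r) Lc (KInvStep (d := d) Lc j)) Lc S M μ y) := by
  obtain ⟨CQ, δQ, hδQ, hQ⟩ := exists_vertexFamily_dM hr j hS hδs hM hδM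
  exact ⟨_, _, _, _, hδQ, hQ μ y⟩

/-- [folklore] `G_j` is spread (an5's `Spr`). -/
theorem spr_G (hr : r ∈ box (d + 1) Lc) (j : ℕ) : Spr (coDressKBmAt (toSite r) Lc (KInvStep (d := d) Lc j)) := by
  obtain ⟨δG, CG, hδG, _, hG⟩ := decays_coDressKBmAt_KInvStep (d := d) hr j
  exact ⟨_, _, hδG, hG⟩

/-- NOT IN PRINT; OUR BOOKKEEPING.  **THE (SLOT, RIGHT-LEG) PAIR SUM OF THE CHAIN-RULE DERIVATIVE** (every `j`, in-block root, ANY `S`, `M`, bounded leg weight `ρ₂`, fixed left leg `z`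
and fibre legs `f b`): `Σ'_{(u′,w)} ρ₂(w)·(dM G_j Lc S M κ′ u′) z w f b = Σ'_w ρ₂(w)·cH_j·Σ'_t 𝟙[t_{κ′} % Lc = Lc−1]·S κ′ t z w f b` — Fubini on the summable pair family
(`ExchangeSlotResum.summable_pair_slot`), the slot innermost, then Part 27's `hasSum_slot_dM`. -/
theorem tsum_pair_slot_dM (hr : r ∈ box (d + 1) Lc) (j : ℕ) (hS : LocStencil S Cs δs) (hδs : 0 < δs) (hM : VertexFamily M Lc CM δM) (hδM : 0 < δM)
    {ρ₂ : Site (d + 1) → ℝ} (h₂ : ∀ w, |ρ₂ w| ≤ 1) (κ' : Fin (d + 1)) (z : Site (d + 1)) (f b : Fib d) :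
    ∑' uw : Site (d + 1) × Site (d + 1), ρ₂ uw.2 * dM (coDressKBmAt (toSite r) Lc (KInvStep (d := d) Lc j)) Lc S M κ' uw.1 z uw.2 f b
      = ∑' w : Site (d + 1), ρ₂ w * ((stepScale d Lc j * (Lc : ℝ) ^ (d + 1))⁻¹ *
          ∑' t : Site (d + 1), (if t κ' % (Lc : ℤ) = (Lc : ℤ) - 1 then S κ' t z w f b else 0)) := by
  obtain ⟨CQ, δQ, hδQ, hQ⟩ := exists_vertexFamily_dM hr j hS hδs hM hδM
  have hSm := summable_pair_slot (N := Lc) (fun u' => dM (coDressKBmAt (toSite r) Lc (KInvStep (d := d) Lc j)) Lc S M κ' u') hδQ (fun u' => hQ κ' u') h₂ z f b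
  have hSm' : Summable fun wu : Site (d + 1) × Site (d + 1) =>
      ρ₂ wu.1 * dM (coDressKBmAt (toSite r) Lc (KInvStep (d := d) Lc j)) Lc S M κ' wu.2 z wu.1 f b :=
    ((Equiv.prodComm (Site (d + 1)) (Site (d + 1))).summable_iff (f := fun uw : Site (d + 1) × Site (d + 1) =>
      ρ₂ uw.2 * dM (coDressKBmAt (toSite r) Lc (KInvStep (d := d) Lc j)) Lc S M κ' uw.1 z uw.2 f b)).2 hSm
  rw [← (Equiv.prodComm (Site (d + 1)) (Site (d + 1))).tsum_eq (fun uw : Site (d + 1) × Site (d + 1) =>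
    ρ₂ uw.2 * dM (coDressKBmAt (toSite r) Lc (KInvStep (d := d) Lc j)) Lc S M κ' uw.1 z uw.2 f b)]
  show ∑' wu : Site (d + 1) × Site (d + 1), ρ₂ wu.1 * dM (coDressKBmAt (toSite r) Lc (KInvStep (d := d) Lc j)) Lc S M κ' wu.2 z wu.1 f b = _
  rw [hSm'.tsum_prod]
  refine tsum_congr fun w => ?_
  show ∑' u' : Site (d + 1), ρ₂ w * dM (coDressKBmAt (toSite r) Lc (KInvStep (d := d) Lc j)) Lc S M κ' u' z w f b = _
  rw [tsum_mul_left, (hasSum_slot_dM hr j hS hδs hM hδM κ' z w f b).tsum_eq]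

/-- NOT IN PRINT; OUR BOOKKEEPING.  **THE (SLOT, LEFT-LEG) PAIR SUM OF THE CHAIN-RULE DERIVATIVE** (fixed right leg `z`, fibre legs `a f`):
`Σ'_{(u′,y)} ρ₁(y)·(dM G_j Lc S M κ′ u′) y z a f = Σ'_y ρ₁(y)·cH_j·Σ'_t 𝟙[t_{κ′} % Lc = Lc−1]·S κ′ t y z a f` (the same through the transposed kernels `trK`). -/
theorem tsum_pair_slot_dM_left (hr : r ∈ box (d + 1) Lc) (j : ℕ) (hS : LocStencil S Cs δs) (hδs : 0 < δs) (hM : VertexFamily M Lc CM δM) (hδM : 0 < δM)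
    {ρ₁ : Site (d + 1) → ℝ} (h₁ : ∀ y, |ρ₁ y| ≤ 1) (κ' : Fin (d + 1)) (z : Site (d + 1)) (a f : Fib d) :
    ∑' uy : Site (d + 1) × Site (d + 1), ρ₁ uy.2 * dM (coDressKBmAt (toSite r) Lc (KInvStep (d := d) Lc j)) Lc S M κ' uy.1 uy.2 z a f
      = ∑' y : Site (d + 1), ρ₁ y * ((stepScale d Lc j * (Lc : ℝ) ^ (d + 1))⁻¹ *
          ∑' t : Site (d + 1), (if t κ' % (Lc : ℤ) = (Lc : ℤ) - 1 then S κ' t y z a f else 0)) := by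
  obtain ⟨CQ, δQ, hδQ, hQ⟩ := exists_vertexFamily_dM hr j hS hδs hM hδM
  have hSm := summable_pair_slot (N := Lc) (fun u' => trK (dM (coDressKBmAt (toSite r) Lc (KInvStep (d := d) Lc j)) Lc S M κ' u')) hδQ
    (fun u' => biLoc_trK (hQ κ' u')) h₁ z f a
  simp only [trK_apply] at hSm
  have hSm' : Summable fun yu : Site (d + 1) × Site (d + 1) =>
      ρ₁ yu.1 * dM (coDressKBmAt (toSite r) Lc (KInvStep (d := d) Lc j)) Lc S M κ' yu.2 yu.1 z a f :=
    ((Equiv.prodComm (Site (d + 1)) (Site (d + 1))).summable_iff (f := fun uy : Site (d + 1) × Site (d + 1) =>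
      ρ₁ uy.2 * dM (coDressKBmAt (toSite r) Lc (KInvStep (d := d) Lc j)) Lc S M κ' uy.1 uy.2 z a f)).2 hSm
  rw [← (Equiv.prodComm (Site (d + 1)) (Site (d + 1))).tsum_eq (fun uy : Site (d + 1) × Site (d + 1) =>
    ρ₁ uy.2 * dM (coDressKBmAt (toSite r) Lc (KInvStep (d := d) Lc j)) Lc S M κ' uy.1 uy.2 z a f)]
  show ∑' yu : Site (d + 1) × Site (d + 1), ρ₁ yu.1 * dM (coDressKBmAt (toSite r) Lc (KInvStep (d := d) Lc j)) Lc S M κ' yu.2 yu.1 z a f = _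
  rw [hSm'.tsum_prod]
  refine tsum_congr fun y => ?_
  show ∑' u' : Site (d + 1), ρ₁ y * dM (coDressKBmAt (toSite r) Lc (KInvStep (d := d) Lc j)) Lc S M κ' u' y z a f = _
  rw [tsum_mul_left, (hasSum_slot_dM hr j hS hδs hM hδM κ' y z a f).tsum_eq]

/-! ## §2 The slot zero mode of a face-weighted two-face word with the chain-rule derivative in the right ∕ left slot -/

/-- NOT IN PRINT; OUR BOOKKEEPING.  **THE SLOT ZERO MODE OF `FF[A ∘ dM_{κ′u′}]`** (every `j`, in-block root, ANY `S`, `M`, ANY localised `A`, leg weights bounded by `1`,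
fibre legs `a b`): `HasSum (u′ ↦ Σ'_{(y,w)} ρ₁(y)ρ₂(w)·(A ∘ dM G_j Lc S M κ′ u′) y w a b) (Σ_f Σ'_{(y,z)} ρ₁(y)·A y z a f·Σ'_w ρ₂(w)·cH_j·Σ'_t 𝟙[t_{κ′} % Lc = Lc−1]·S κ′ t z w f b)`
— leaf-04's `hasSum_slot_word` with the pair sum of §1. -/
theorem hasSum_slot_word_dM_right (hr : r ∈ box (d + 1) Lc) (j : ℕ) (hS : LocStencil S Cs δs) (hδs : 0 < δs) (hM : VertexFamily M Lc CM δM) (hδM : 0 < δM)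
    {A : MKer (d + 1) (Fib d)} (hA : Loc A) {ρ₁ ρ₂ : Site (d + 1) → ℝ} (h₁ : ∀ y, |ρ₁ y| ≤ 1) (h₂ : ∀ w, |ρ₂ w| ≤ 1) (κ' : Fin (d + 1)) (a b : Fib d) :
    HasSum (fun u' : Site (d + 1) => ∑' yw : Site (d + 1) × Site (d + 1),
        ρ₁ yw.1 * ρ₂ yw.2 * comp A (dM (coDressKBmAt (toSite r) Lc (KInvStep (d := d) Lc j)) Lc S M κ' u') yw.1 yw.2 a b)
      (∑ f : Fib d, ∑' yz : Site (d + 1) × Site (d + 1), ρ₁ yz.1 * A yz.1 yz.2 a f *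
        ∑' w : Site (d + 1), ρ₂ w * ((stepScale d Lc j * (Lc : ℝ) ^ (d + 1))⁻¹ *
          ∑' t : Site (d + 1), (if t κ' % (Lc : ℤ) = (Lc : ℤ) - 1 then S κ' t yz.2 w f b else 0))) := by
  obtain ⟨p, q, CA, δA, hδA, hAb⟩ := hA
  obtain ⟨CQ, δQ, hδQ, hQ⟩ := exists_vertexFamily_dM hr j hS hδs hM hδM
  have hδ : 0 < min δA δQ := lt_min hδA hδQ
  have hA' : BiLoc A p q |CA| (min δA δQ) := biLoc_of_le hAb (min_le_left _ _)
  have hQ' : ∀ u' : Site (d + 1), BiLoc (dM (coDressKBmAt (toSite r) Lc (KInvStep (d := d) Lc j)) Lc S M κ' u') ((Lc : ℤ) • u') ((Lc : ℤ) • u') |CQ| (min δA δQ) :=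
    fun u' => biLoc_of_le (hQ κ' u') (min_le_right _ _)
  have h := hasSum_slot_word (N := Lc) (A := A) (Q := fun u' => dM (coDressKBmAt (toSite r) Lc (KInvStep (d := d) Lc j)) Lc S M κ' u')
    (ρ₁ := ρ₁) (ρ₂ := ρ₂) hδ hA' hQ' h₁ h₂ a b
  simp only [tsum_pair_slot_dM hr j hS hδs hM hδM h₂ κ'] at h
  exact h

/-- NOT IN PRINT; OUR BOOKKEEPING.  **THE SLOT ZERO MODE OF `FF[dM_{κ′u′} ∘ B]`** (ANY localised `B`):
`HasSum (u′ ↦ Σ'_{(y,w)} ρ₁(y)ρ₂(w)·(dM G_j Lc S M κ′ u′ ∘ B) y w a b) (Σ_f Σ'_{(w,z)} ρ₂(w)·B z w f b·Σ'_y ρ₁(y)·cH_j·Σ'_t 𝟙[t_{κ′} % Lc = Lc−1]·S κ′ t y z a f)`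
— leaf-04's `hasSum_slot_word_left` with the left pair sum of §1. -/
theorem hasSum_slot_word_dM_left (hr : r ∈ box (d + 1) Lc) (j : ℕ) (hS : LocStencil S Cs δs) (hδs : 0 < δs) (hM : VertexFamily M Lc CM δM) (hδM : 0 < δM)
    {B : MKer (d + 1) (Fib d)} (hB : Loc B) {ρ₁ ρ₂ : Site (d + 1) → ℝ} (h₁ : ∀ y, |ρ₁ y| ≤ 1) (h₂ : ∀ w, |ρ₂ w| ≤ 1) (κ' : Fin (d + 1)) (a b : Fib d) :
    HasSum (fun u' : Site (d + 1) => ∑' yw : Site (d + 1) × Site (d + 1),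
        ρ₁ yw.1 * ρ₂ yw.2 * comp (dM (coDressKBmAt (toSite r) Lc (KInvStep (d := d) Lc j)) Lc S M κ' u') B yw.1 yw.2 a b)
      (∑ f : Fib d, ∑' wz : Site (d + 1) × Site (d + 1), ρ₂ wz.1 * B wz.2 wz.1 f b *
        ∑' y : Site (d + 1), ρ₁ y * ((stepScale d Lc j * (Lc : ℝ) ^ (d + 1))⁻¹ *
          ∑' t : Site (d + 1), (if t κ' % (Lc : ℤ) = (Lc : ℤ) - 1 then S κ' t y wz.2 a f else 0))) := by
  obtain ⟨p, q, CB, δB, hδB, hBb⟩ := hB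
  obtain ⟨CQ, δQ, hδQ, hQ⟩ := exists_vertexFamily_dM hr j hS hδs hM hδM
  have hδ : 0 < min δB δQ := lt_min hδB hδQ
  have hB' : BiLoc B p q |CB| (min δB δQ) := biLoc_of_le hBb (min_le_left _ _)
  have hQ' : ∀ u' : Site (d + 1), BiLoc (dM (coDressKBmAt (toSite r) Lc (KInvStep (d := d) Lc j)) Lc S M κ' u') ((Lc : ℤ) • u') ((Lc : ℤ) • u') |CQ| (min δB δQ) :=
    fun u' => biLoc_of_le (hQ κ' u') (min_le_right _ _)
  have h := hasSum_slot_word_left (N := Lc) (B := B) (Q := fun u' => dM (coDressKBmAt (toSite r) Lc (KInvStep (d := d) Lc j)) Lc S M κ' u')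
    (ρ₁ := ρ₁) (ρ₂ := ρ₂) hδ hB' hQ' h₁ h₂ a b
  simp only [tsum_pair_slot_dM_left hr j hS hδs hM hδM h₁ κ'] at h
  exact h

end Generic

/-! ## §3 The wall: the two contact words of the interior `Y_j` -/

section Wall

variable (cE cVH cΛ : ℝ)

/-- [folklore] The wall's chain-rule derivative `dM_{μy} = dM G_j Lc (SpureRecAt j) (M1At j) μ y` is localised (in-block root, `1 ≤ Lc`; Part 24's `loc_dM_wall`, re-derived at
the bottom of this import cone from `locStencil_SpureRecAt` ∕ `vertexFamily_M1At`). -/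
theorem loc_dM_wall (hLc : 1 ≤ Lc) (hr : r ∈ box (d + 1) Lc) (j : ℕ) (μ : Fin (d + 1)) (y : Site (d + 1)) :
    Loc (dM (coDressKBmAt (toSite r) Lc (KInvStep (d := d) Lc j)) Lc (SpureRecAt d Lc (toSite r) cE cVH cΛ j) (M1At d Lc (toSite r) cΛ j) μ y) := by
  obtain ⟨Cs, δs, hδs, hS⟩ := locStencil_SpureRecAt (d := d) hLc hr cE cVH cΛ j
  exact loc_dM_wall' hr j hS hδs (vertexFamily_M1At hLc hr cΛ j zero_le_one) one_pos μ y

/-- [folklore] **RE-BRACKETING THE LEFT CONTACT WORD**: `(dM_{b′} ∘ G_j) ∘ dM_b = dM_{b′} ∘ (G_j ∘ dM_b)` (an5's `comp_assoc_tame`; all three factors tame). -/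
theorem comp_assoc_contact_wall (hLc : 1 ≤ Lc) (hr : r ∈ box (d + 1) Lc) (j : ℕ) (κ : Fin (d + 1)) (u : Site (d + 1)) (κ' : Fin (d + 1)) (u' : Site (d + 1)) :
    comp (comp (dM (coDressKBmAt (toSite r) Lc (KInvStep (d := d) Lc j)) Lc (SpureRecAt d Lc (toSite r) cE cVH cΛ j) (M1At d Lc (toSite r) cΛ j) κ' u')
        (coDressKBmAt (toSite r) Lc (KInvStep (d := d) Lc j)))
      (dM (coDressKBmAt (toSite r) Lc (KInvStep (d := d) Lc j)) Lc (SpureRecAt d Lc (toSite r) cE cVH cΛ j) (M1At d Lc (toSite r) cΛ j) κ u)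
    = comp (dM (coDressKBmAt (toSite r) Lc (KInvStep (d := d) Lc j)) Lc (SpureRecAt d Lc (toSite r) cE cVH cΛ j) (M1At d Lc (toSite r) cΛ j) κ' u')
        (comp (coDressKBmAt (toSite r) Lc (KInvStep (d := d) Lc j))
          (dM (coDressKBmAt (toSite r) Lc (KInvStep (d := d) Lc j)) Lc (SpureRecAt d Lc (toSite r) cE cVH cΛ j) (M1At d Lc (toSite r) cΛ j) κ u)) :=
  (comp_assoc_tame (loc_dM_wall cE cVH cΛ hLc hr j κ' u').tame (spr_G hr j).tame (loc_dM_wall cE cVH cΛ hLc hr j κ u).tame).symm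

/-- NOT IN PRINT; OUR BOOKKEEPING.  **THE SLOT ZERO MODE OF THE RIGHT CONTACT WORD `dM_{κu} G_j dM_{κ′u′}`** (every `j`, in-block root, `1 ≤ Lc`, ANY pins, bounded leg weights,
fibre legs `a b`): `HasSum (u′ ↦ FF^{ρ₁ρ₂}_{ab}[(dM_{κu} ∘ G_j) ∘ dM_{κ′u′}]) (Σ_f Σ'_{(y,z)} ρ₁(y)·(dM_{κu} ∘ G_j) y z a f·Σ'_w ρ₂(w)·cH_j·Σ'_t 𝟙[t_{κ′} % Lc = Lc−1]·SpureRecAt j κ′ t z w f b)`. -/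
theorem hasSum_slot_contactWord_right (hLc : 1 ≤ Lc) (hr : r ∈ box (d + 1) Lc) (j : ℕ) (κ : Fin (d + 1)) (u : Site (d + 1)) (κ' : Fin (d + 1))
    {ρ₁ ρ₂ : Site (d + 1) → ℝ} (h₁ : ∀ y, |ρ₁ y| ≤ 1) (h₂ : ∀ w, |ρ₂ w| ≤ 1) (a b : Fib d) :
    HasSum (fun u' : Site (d + 1) => ∑' yw : Site (d + 1) × Site (d + 1), ρ₁ yw.1 * ρ₂ yw.2 *
        comp (comp (dM (coDressKBmAt (toSite r) Lc (KInvStep (d := d) Lc j)) Lc (SpureRecAt d Lc (toSite r) cE cVH cΛ j) (M1At d Lc (toSite r) cΛ j) κ u)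
            (coDressKBmAt (toSite r) Lc (KInvStep (d := d) Lc j)))
          (dM (coDressKBmAt (toSite r) Lc (KInvStep (d := d) Lc j)) Lc (SpureRecAt d Lc (toSite r) cE cVH cΛ j) (M1At d Lc (toSite r) cΛ j) κ' u') yw.1 yw.2 a b)
      (∑ f : Fib d, ∑' yz : Site (d + 1) × Site (d + 1), ρ₁ yz.1 *
        comp (dM (coDressKBmAt (toSite r) Lc (KInvStep (d := d) Lc j)) Lc (SpureRecAt d Lc (toSite r) cE cVH cΛ j) (M1At d Lc (toSite r) cΛ j) κ u)
          (coDressKBmAt (toSite r) Lc (KInvStep (d := d) Lc j)) yz.1 yz.2 a f *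
        ∑' w : Site (d + 1), ρ₂ w * ((stepScale d Lc j * (Lc : ℝ) ^ (d + 1))⁻¹ *
          ∑' t : Site (d + 1), (if t κ' % (Lc : ℤ) = (Lc : ℤ) - 1 then SpureRecAt d Lc (toSite r) cE cVH cΛ j κ' t yz.2 w f b else 0))) := by
  obtain ⟨Cs, δs, hδs, hS⟩ := locStencil_SpureRecAt (d := d) hLc hr cE cVH cΛ j
  exact hasSum_slot_word_dM_right hr j hS hδs (vertexFamily_M1At hLc hr cΛ j zero_le_one) one_pos
    ((loc_dM_wall cE cVH cΛ hLc hr j κ u).comp_spr (spr_G hr j)) h₁ h₂ κ' a b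

/-- NOT IN PRINT; OUR BOOKKEEPING.  **THE SLOT ZERO MODE OF THE LEFT CONTACT WORD `dM_{κ′u′} G_j dM_{κu}`** (as displayed in Part 26, left-bracketed):
`HasSum (u′ ↦ FF^{ρ₁ρ₂}_{ab}[(dM_{κ′u′} ∘ G_j) ∘ dM_{κu}]) (Σ_f Σ'_{(w,z)} ρ₂(w)·(G_j ∘ dM_{κu}) z w f b·Σ'_y ρ₁(y)·cH_j·Σ'_t 𝟙[t_{κ′} % Lc = Lc−1]·SpureRecAt j κ′ t y z a f)`. -/
theorem hasSum_slot_contactWord_left (hLc : 1 ≤ Lc) (hr : r ∈ box (d + 1) Lc) (j : ℕ) (κ : Fin (d + 1)) (u : Site (d + 1)) (κ' : Fin (d + 1))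
    {ρ₁ ρ₂ : Site (d + 1) → ℝ} (h₁ : ∀ y, |ρ₁ y| ≤ 1) (h₂ : ∀ w, |ρ₂ w| ≤ 1) (a b : Fib d) :
    HasSum (fun u' : Site (d + 1) => ∑' yw : Site (d + 1) × Site (d + 1), ρ₁ yw.1 * ρ₂ yw.2 *
        comp (comp (dM (coDressKBmAt (toSite r) Lc (KInvStep (d := d) Lc j)) Lc (SpureRecAt d Lc (toSite r) cE cVH cΛ j) (M1At d Lc (toSite r) cΛ j) κ' u')
            (coDressKBmAt (toSite r) Lc (KInvStep (d := d) Lc j)))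
          (dM (coDressKBmAt (toSite r) Lc (KInvStep (d := d) Lc j)) Lc (SpureRecAt d Lc (toSite r) cE cVH cΛ j) (M1At d Lc (toSite r) cΛ j) κ u) yw.1 yw.2 a b)
      (∑ f : Fib d, ∑' wz : Site (d + 1) × Site (d + 1), ρ₂ wz.1 *
        comp (coDressKBmAt (toSite r) Lc (KInvStep (d := d) Lc j))
          (dM (coDressKBmAt (toSite r) Lc (KInvStep (d := d) Lc j)) Lc (SpureRecAt d Lc (toSite r) cE cVH cΛ j) (M1At d Lc (toSite r) cΛ j) κ u) wz.2 wz.1 f b *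
        ∑' y : Site (d + 1), ρ₁ y * ((stepScale d Lc j * (Lc : ℝ) ^ (d + 1))⁻¹ *
          ∑' t : Site (d + 1), (if t κ' % (Lc : ℤ) = (Lc : ℤ) - 1 then SpureRecAt d Lc (toSite r) cE cVH cΛ j κ' t y wz.2 a f else 0))) := by
  obtain ⟨Cs, δs, hδs, hS⟩ := locStencil_SpureRecAt (d := d) hLc hr cE cVH cΛ j
  have h := hasSum_slot_word_dM_left hr j hS hδs (vertexFamily_M1At hLc hr cΛ j zero_le_one) one_pos
    ((spr_G hr j).comp_loc (loc_dM_wall cE cVH cΛ hLc hr j κ u)) h₁ h₂ κ' a b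
  refine h.congr_fun fun u' => ?_
  rw [comp_assoc_contact_wall cE cVH cΛ hLc hr j κ u κ' u']

/-- NOT IN PRINT; OUR BOOKKEEPING.  **THE SLOT ZERO MODE OF THE CONTACT PART OF THE INTERIOR** `dM_{κu} G_j dM_{κ′u′} + dM_{κ′u′} G_j dM_{κu}` (the first two words of Part 26's
`Y_j(κu; κ′u′)`): the face-weighted pair sum of the sum, summed over the slot `u′`, is the sum of the two displayed slot zero modes (the pair sum splits by
`TwoFaceWordAdditive.summable_twoFace_of_loc`). -/
theorem hasSum_slot_contactWords (hLc : 1 ≤ Lc) (hr : r ∈ box (d + 1) Lc) (j : ℕ) (κ : Fin (d + 1)) (u : Site (d + 1)) (κ' : Fin (d + 1))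
    {ρ₁ ρ₂ : Site (d + 1) → ℝ} (h₁ : ∀ y, |ρ₁ y| ≤ 1) (h₂ : ∀ w, |ρ₂ w| ≤ 1) (a b : Fib d) :
    HasSum (fun u' : Site (d + 1) => ∑' yw : Site (d + 1) × Site (d + 1), ρ₁ yw.1 * ρ₂ yw.2 *
        (comp (comp (dM (coDressKBmAt (toSite r) Lc (KInvStep (d := d) Lc j)) Lc (SpureRecAt d Lc (toSite r) cE cVH cΛ j) (M1At d Lc (toSite r) cΛ j) κ u)
              (coDressKBmAt (toSite r) Lc (KInvStep (d := d) Lc j)))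
            (dM (coDressKBmAt (toSite r) Lc (KInvStep (d := d) Lc j)) Lc (SpureRecAt d Lc (toSite r) cE cVH cΛ j) (M1At d Lc (toSite r) cΛ j) κ' u') +
          comp (comp (dM (coDressKBmAt (toSite r) Lc (KInvStep (d := d) Lc j)) Lc (SpureRecAt d Lc (toSite r) cE cVH cΛ j) (M1At d Lc (toSite r) cΛ j) κ' u')
              (coDressKBmAt (toSite r) Lc (KInvStep (d := d) Lc j)))
            (dM (coDressKBmAt (toSite r) Lc (KInvStep (d := d) Lc j)) Lc (SpureRecAt d Lc (toSite r) cE cVH cΛ j) (M1At d Lc (toSite r) cΛ j) κ u)) yw.1 yw.2 a b)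
      ((∑ f : Fib d, ∑' yz : Site (d + 1) × Site (d + 1), ρ₁ yz.1 *
          comp (dM (coDressKBmAt (toSite r) Lc (KInvStep (d := d) Lc j)) Lc (SpureRecAt d Lc (toSite r) cE cVH cΛ j) (M1At d Lc (toSite r) cΛ j) κ u)
            (coDressKBmAt (toSite r) Lc (KInvStep (d := d) Lc j)) yz.1 yz.2 a f *
          ∑' w : Site (d + 1), ρ₂ w * ((stepScale d Lc j * (Lc : ℝ) ^ (d + 1))⁻¹ *
            ∑' t : Site (d + 1), (if t κ' % (Lc : ℤ) = (Lc : ℤ) - 1 then SpureRecAt d Lc (toSite r) cE cVH cΛ j κ' t yz.2 w f b else 0))) +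
        ∑ f : Fib d, ∑' wz : Site (d + 1) × Site (d + 1), ρ₂ wz.1 *
          comp (coDressKBmAt (toSite r) Lc (KInvStep (d := d) Lc j))
            (dM (coDressKBmAt (toSite r) Lc (KInvStep (d := d) Lc j)) Lc (SpureRecAt d Lc (toSite r) cE cVH cΛ j) (M1At d Lc (toSite r) cΛ j) κ u) wz.2 wz.1 f b *
          ∑' y : Site (d + 1), ρ₁ y * ((stepScale d Lc j * (Lc : ℝ) ^ (d + 1))⁻¹ *
            ∑' t : Site (d + 1), (if t κ' % (Lc : ℤ) = (Lc : ℤ) - 1 then SpureRecAt d Lc (toSite r) cE cVH cΛ j κ' t y wz.2 a f else 0))) := by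
  have h := (hasSum_slot_contactWord_right cE cVH cΛ hLc hr j κ u κ' h₁ h₂ a b).add (hasSum_slot_contactWord_left cE cVH cΛ hLc hr j κ u κ' h₁ h₂ a b)
  refine h.congr_fun fun u' => ?_
  have hR : Loc (comp (comp (dM (coDressKBmAt (toSite r) Lc (KInvStep (d := d) Lc j)) Lc (SpureRecAt d Lc (toSite r) cE cVH cΛ j) (M1At d Lc (toSite r) cΛ j) κ u)
        (coDressKBmAt (toSite r) Lc (KInvStep (d := d) Lc j)))
      (dM (coDressKBmAt (toSite r) Lc (KInvStep (d := d) Lc j)) Lc (SpureRecAt d Lc (toSite r) cE cVH cΛ j) (M1At d Lc (toSite r) cΛ j) κ' u')) :=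
    ((loc_dM_wall cE cVH cΛ hLc hr j κ u).comp_spr (spr_G hr j)).comp (loc_dM_wall cE cVH cΛ hLc hr j κ' u')
  have hL : Loc (comp (comp (dM (coDressKBmAt (toSite r) Lc (KInvStep (d := d) Lc j)) Lc (SpureRecAt d Lc (toSite r) cE cVH cΛ j) (M1At d Lc (toSite r) cΛ j) κ' u')
        (coDressKBmAt (toSite r) Lc (KInvStep (d := d) Lc j)))
      (dM (coDressKBmAt (toSite r) Lc (KInvStep (d := d) Lc j)) Lc (SpureRecAt d Lc (toSite r) cE cVH cΛ j) (M1At d Lc (toSite r) cΛ j) κ u)) :=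
    ((loc_dM_wall cE cVH cΛ hLc hr j κ' u').comp_spr (spr_G hr j)).comp (loc_dM_wall cE cVH cΛ hLc hr j κ u)
  rw [← (summable_twoFace_of_loc hR h₁ h₂ a b).tsum_add (summable_twoFace_of_loc hL h₁ h₂ a b)]
  exact (tsum_congr fun yw => by simp only [Pi.add_apply]; ring).symm

end Wall

end Summit.QuantumFields.BalabanUV.Beta.GAN24.ContactWordSlotZeroMode

end
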